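import Mathlib
import HarnessLib
import HarnessLib.Audit
import Summits.MatrixMultiplication.Statement
import Literature.Combinatorics.Additive.TripleProductProperty
import Literature.Computability.AlgebraicComplexity.CohnUmansTPPProofs
import Literature.RepresentationTheory.FiniteGroups.CharacterDegrees
import HarnessLib.Audit.Status.Attr

/-!
Route: CongruenceTowerPacking

DORMANT since 2026-08-21T16:46:55Z (reconciler: no traction for 5 d (last activity item-evidence-added at 2026-08-16T16:18:28Z); parked, not closed — `ledger route dormant route-MatrixMultiplication-CongruenceTowerPacking --off` to reac) — unstaffed, not closed; items shared with open routes are served there. `ledger route dormant <id> --off` reactivates.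

# Route CongruenceTowerPacking — decide the congruence-tower host — TPP designs in U_n(Z/p^k), k →
∞, beat CKSU Cor. 1.9 (ω = 2) or the Hensel box-collapse is a catalogued barrier

It suffices to show X = CorNineteenBeaten: for every exponent τ > 2 some finite group G carries a
triple-product-property
triple (S, T, U) with d_max(G)^(τ−2)·|G| < (|S||T||U|)^(τ/3); since Cor. 1.9 of
CohnKleinbergSzegedyUmans2005
((nmp)^(ω/3) ≤ d_max^(ω−2)|G|, PROVED in tree as CKSU2005_cor19_holds) would fail at τ = ω(ℂ) if
ω(ℂ) > 2, X gives ω(ℂ) ≤ 2,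
and ω(ℂ) ≥ 2 is omega_two_le — the deciding theorem `closes : CorNineteenBeaten →
MatrixMultiplication` is proved in glue.lean.
The route proposes ONE host for X and files the decision problem it poses, realising two cards at
once: the congruence towers
G_k = U_n(ℤ/p^k) (p prime and n ≥ 2 FIXED — n = 2 is abelian and satisfies neither positive crux —
depth k → ∞; card unipotent-congruence-towers, positive side: cruxes TowerPackingTight ⊇
TowerCapacityGain, support DegreeLeIndexAbelian giving d_max(G_k) ≤ [G_k : A] = |G_k|^(1/2 − c_n),
c_n ≥ 1/(2n) > 0, uniformly in k)
versus the barrier card nonarchimedean-lie-tpp-collapse (negative side, spine: crux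
TowerPackingFailure = ¬TowerPackingTight up to
bookkeeping, the claim ¬TowerCapacityGain, and its provable core AnalyticBoxBarrier — reductions of
analytic charts are capped by the
abelian top congruence layer, so any tight design must be digit-restricted at ≥ half of the scales).
Lean: `∀ τ : ℝ, 2 < τ → ∃ (G : Type) (_ : Group G) (_ : Fintype G) (S T U : Finset G),
Literature.Combinatorics.Additive.TripleProductProperty S T U ∧
(Literature.RepresentationTheory.FiniteGroups.maxCharDegree G : ℝ) ^ (τ - 2) * (Fintype.card G : ℝ)
< ((S.card * T.card * U.card : ℕ) : ℝ) ^ (τ / 3)`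

## Assembly
Pure logic plus two PROVED tree theorems, written out in glue.lean as `theorem closes (h :
CorNineteenBeaten) : MatrixMultiplication`
(lean check rc 0, axioms propext/Classical.choice/Quot.sound): rewrite with
MatrixMultiplication_iff; if ω(ℂ) ≠ 2 then ω(ℂ) > 2 by
omega_two_le; apply X at τ := ω(ℂ) to get G, S, T, U with d_max^(ω−2)|G| < (|S||T||U|)^(ω/3); ⟨S, T,
U, rfl, rfl, rfl, tpp⟩ is
RealizesTPP G |S| |T| |U| (same inlined predicate), so CKSU2005_cor19_holds gives (|S||T||U|)^(ω/3)
≤ d_max^(ω−2)·Nat.card G =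
d_max^(ω−2)|G| — contradiction. The tower cruxes are NOT hypotheses of closes: TowerPackingTight +
DegreeLeIndexAbelian → X is the
foreseen layer-2 glue (Two-layer plan); TowerPackingFailure / ¬TowerCapacityGain are the staffed
negative side.

Rationale: WHY THIS LINE. Mechanism: Cohn–Umans designs need a family meeting the packing bound |S||T||U| =
|G|^(3/2−o(1)) (BlasiakCohnGrochowPrattUmans2023 Def. 2.3)
in hosts whose largest character degree is polynomially SMALLER than |G|^(1/2); the congruence
quotients U_n(ℤ/p^k) of the p-adic
analytic group U_n(ℤ_p) are such hosts for free (abelian block subgroup of index |G|^(1/2−c_n), so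
d_max ≤ index by Isaacs1976
Problem 2.9(b); orbit-method picture DixonEtAl1999 §5.1), they are p-groups of UNBOUNDED exponent
used once each (outside
BlasiakChurchCohnGrochowUmans2017 Cor. 3.20 / Sawin2018, and flagged as not excluded in
arXiv:1712.02302 Ex. 3.13–3.14), have
n(G) = 1 (outside the quasirandom barrier) and are the finite shadow of the Lie programme whose §4
open bullet "other infinite groups
(not necessarily Lie groups)" (arXiv:2410.14905) this line answers one way or the other. Imported
areas: p-adic analytic / uniform
pro-p filtrations (DixonEtAl1999: K_m/K_2m abelian — the engine of AnalyticBoxBarrier), character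
theory of finite groups (Isaacs1976,
Ito), TPP capacity of finite groups (Neumann2011, HedtkeMurthy2012, Murthy2026), and the Lie-group
TPP geometry of
BlasiakCohnGrochowPrattUmans2023 §4 (Thm. 4.7: over ℂ TPP subvarieties have Σ dim ≤ dim G; over ℝ
definiteness saves the packing
bound) whose non-archimedean analogue is the spine card's slogan "Hensel destroys what Archimedes
saves". What it does that prior
routes do not: GroupTheoreticSTPP decides the ABELIAN STPP line and its non-abelian crux
CNonabelianTPPFamilies demands
d_max = N^(o(1)), which excludes every congruence tower; AutomaticSTPPDesigns is abelian ℤ/p^k;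
NilpotentLieHosts is archimedean
U_d(ℤ) with separating polynomials; the retired gen-1 route HenselBoxCollapse concluded only the
barrier — here the same mathematics
sits inside a route whose closes reaches `MatrixMultiplication`, with the barrier as the staffed
negative side of a by-name item.

RANKED CRUXES. #0 CorNineteenBeaten (target) — X: for every τ > 2 there are a finite group G and S,
T, U ⊆ G with the triple product property (CohnUmans2003 Def. 2.1, the tree's TripleProductProperty)
such that d_max(G)^(τ−2)·|G| < (|S||T||U|)^(τ/3) — Cor. 1.9 of CKSU 2005 is beaten at every exponent
above 2 (host-agnostic deciding interface; the tower cruxes below are the proposed witnesses).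
[difficulty: open-problem] (why it might fail: Equivalent in strength to "single-TPP designs push
the Cor. 1.9 bound to 2": packing-bound families exist (CU03 Thm 6, Thm 17: S_{n(n+1)/2}, A≀S_n) but
with d_max ≥ |G|^(1/2−o(1)); no family with d_max ≤ |G|^(1/2−c) meeting it is known.)
[CohnKleinbergSzegedyUmans2005, CohnUmans2003, BlasiakCohnGrochowPrattUmans2023,
lean:Literature.Computability.AlgebraicComplexity.CKSU2005_cor19_holds]
#2 TowerPackingFailure (crux) — THE BARRIER (card nonarchimedean-lie-tpp-collapse, "no bound ω < 3
survives" made honest at the packing scale): for every prime p and every n there is c = c(p, n) > 0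
such that for ALL depths k every triple (S, T, U) of upper unitriangular matrices in GL_n(ℤ/p^k)
with the triple product property has |S||T||U| ≤ p^(k·n(n−1)/2·(3/2 − c)) = |U_n(ℤ/p^k)|^(3/2−c):
fixed-dimension unipotent congruence towers never meet the packing bound (BCGPU23 Def. 2.3).
Equivalent to ¬TowerPackingTight by elementary bookkeeping (a prover settling either should land the
other's negation in the same Theorems file). PROVED for SUBGROUP triples by the tree's normalizer
barrier (|Z(U_n(ℤ/p^k))| = p^k gives c = 1/(2D), D = n(n−1)/2) and for first-order boxes by
AnalyticBoxBarrier; open for digit-restricted subsets. [difficulty: open-problem] (why it might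
fail: May be FALSE: carry-aware digit-restricted designs (card unipotent-congruence-towers) escape
the box barrier; slice rank is powerless at unbounded exponent (BCCGU17 Thm B.8: ℤ/p^k has full
slice rank); only the abelian top window and subgroup triples are controlled.)
[BlasiakCohnGrochowPrattUmans2023, BlasiakChurchCohnGrochowUmans2017, CohnUmans2003, Neumann2011,
Murthy2026, arXiv:2410.14905,
lean:Literature.Barriers.MatrixMultiplication.NormalizerBarrier.normalizerBarrier_holds]
#3 TowerCapacityGain (crux) — FIRST MILESTONE / the card's literal collapse claim negated: there are
a prime p, a dimension n ≥ 2 and η > 0 such that for infinitely many depths k some TPP triple of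
upper unitriangular matrices in GL_n(ℤ/p^k) has |S||T||U| ≥ p^(k·n(n−1)/2·(1+η)) =
|U_n(ℤ/p^k)|^(1+η) — a k-UNIFORM capacity gain survives in the tower. The spine card asserts the
negation (capacity |G_k|^(1+o(1)): "p-adic TPP triples collapse under reduction mod p^k");
TowerPackingTight implies it (k(δ) → ∞ as δ → 0 since β(G) < |G|^(3/2), Neumann2011 Cor. 3.2). Both
sides staffed; computable at small (p, k). [difficulty: L] (why it might fail: The card's cascade
may be right: level-1 gains (CU03 Cor. 15: extraspecial q^5, capacity |G|^(6/5); Murthy2026 Thm 3.1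
class 2) need not propagate in k — the tower has no product structure and its windows K_j/K_2j are
abelian (capacity exactly |window|).) [CohnUmans2003, Murthy2026, Neumann2011, HedtkeMurthy2012,
Hedtke2011, DixonEtAl1999]
#4 TowerPackingTight (crux) — THE CONSTRUCTION (card unipotent-congruence-towers, crux (3) there):
for some prime p and n ≥ 2, for every δ > 0 some depth k ≥ 1 admits a TPP triple of upper
unitriangular matrices in GL_n(ℤ/p^k) with |S||T||U| ≥ p^(k·n(n−1)/2·(3/2 − δ)) — the tower meets
the packing bound. With DegreeLeIndexAbelian (d_max(U_n(ℤ/p^k)) ≤ p^(k(D − ⌊n²/4⌋)) = |G_k|^(1/2 −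
c_n), c_n = (2⌊n²/4⌋ − D)/(2D) = 1/(2n) for odd n, 1/(2(n−1)) for even n) it implies the target by
Cor. 1.9 bookkeeping: given τ > 2 take δ < 3c_n(τ−2)/τ. [deps: DegreeLeIndexAbelian] [difficulty:
open-problem] (why it might fail: Probably false (it is ¬TowerPackingFailure): subgroup triples are
capped at exponent 3/2 − 1/(2D) (normalizer barrier, Murthy2026), first-order boxes at the abelian
bound (AnalyticBoxBarrier); no packing-bound family is known in any p-group or Lie-type host
(BCGPU23 p. 3).) [BlasiakCohnGrochowPrattUmans2023, CohnUmans2003, CohnKleinbergSzegedyUmans2005,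
arXiv:1712.02302, arXiv:2410.14905, Isaacs1976]
#9 AnalyticBoxBarrier (support) — The spine card's collapse lemma in its true, provable form (gen-1
target, re-filed as support): let R = ℤ/p^k with m < k ≤ 2m and π = p^m (so π² = 0 and K_m = 1 +
π·M_n(R) is ABELIAN); if S ⊆ g₁(1 + π D₁(R^a)), T ⊆ g₂(1 + π D₂(R^b)), U ⊆ g₃(1 + π D₃(R^c)) are
first-order boxes (= images mod p^k of analytic charts inside one residue class mod p^m) whose
conjugated tangents gᵢDᵢ(·)gᵢ⁻¹ lie in a d-generated submodule L ≤ M_n(R), and (S, T, U) has the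
TPP, then |S||T||U| ≤ p^((k−m)d) = |πR|^d. Proof: right-translate by gᵢ⁻¹ (TPP-invariant,
Neumann2011 Obs. 2.1) into the abelian group 1 + πL, where the product map of a TPP triple is
injective (CohnUmans2003 Lemma 3.1). Consequence: full boxes of ranks a+b+c > d are never TPP — the
discretised p-adic analogue of BCGPU23 Thm 4.7 that FAILS over ℝ (CU03 (U⁺, U⁻, SO_n); BCGPU23 Thm
4.10) — and any design for TowerPackingTight must be digit-restricted at ≥ half of the scales.
[difficulty: provable-now] [CohnUmans2003, Neumann2011, DixonEtAl1999,
BlasiakCohnGrochowPrattUmans2023]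
#9 DegreeLeIndexAbelian (support) — (Isaacs1976 Problem 2.9(b); cf. Ito's Theorem 6.15 for normal A)
every irreducible character degree of a finite group G is at most the index of any abelian subgroup
A ≤ G: d ≤ [G : A] for all d ∈ charDegrees G. The degree engine of the positive side: with A the
abelian block subgroup of U_n(ℤ/p^k) (entries in rows ≤ ⌊n/2⌋, columns > ⌊n/2⌋, |A| = p^(k⌊n²/4⌋))
it gives d_max(U_n(ℤ/p^k)) ≤ p^(k(n(n−1)/2 − ⌊n²/4⌋)) uniformly in k (n = 3: d_max ≤ p^k =
|G|^(1/3)). [difficulty: M] [Isaacs1976, CohnUmans2003]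

TWO-LAYER PLAN. Foreseen glued splits, nothing filed now. (a) CorNineteenBeaten ⇐ TowerPackingTight
→ DegreeLeIndexAbelian → CorNineteenBeaten, glue =
the Cor. 1.9 bookkeeping: move the triple into the subgroup type ↥U_n (TPP is inherited by
subgroups), bound maxCharDegree ↥U_n ≤ [U_n : A]
(csSup_le over charDegrees, nonempty by one_mem_charDegrees) with the explicit abelian block
subgroup A of index p^(k(D − ⌊n²/4⌋)), and
compare exponents of p: (3/2 − δ)τ/3 > (1/2 − c_n)(τ − 2) + 1 once δ < 3c_n(τ−2)/τ. (b)
TowerPackingFailure ⇐ WindowNoGain (no window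
quotient (K_j ∩ U_n)/(K_cj ∩ U_n), c fixed, has k-uniform capacity exponent > 1) → WindowStacking
(CohnUmans2003 short-exact-sequence lemma
α(G) ≤ max over N, G/N read in reverse: a tight family forces a gaining window) →
TowerPackingFailure. (c) TowerCapacityGain ⇐ a level-k₀
digit-restricted design with gain → a carry-aware lifting lemma along k. If TowerPackingTight closes
first, (a) is filed at once and the
route is one glue away from the summit.

KILL CRITERIA. TowerPackingFailure PROVED (or `theorem … : ¬ TowerPackingTight` landed) ⇒ the
positive side is dead: close `refuted:TowerPackingTight`
— this is the spine card's intended outcome and catalogue-grade negative knowledge (congruence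
towers of fixed dimension cannot host the
group-theoretic approach; vendor as Literature/Barriers/MatrixMultiplication/CongruenceTowerBarrier
together with AnalyticBoxBarrier, and
close the sibling cards). ¬TowerCapacityGain proved ⇒ same, stronger (the card's literal collapse).
TowerCapacityGain proved but
TowerPackingTight refuted ⇒ record the gain exponent as the tower's ceiling and close refuted.
TowerPackingTight PROVED ⇒ file glue (a)
and finish: ω = 2. CorNineteenBeaten refuted outright (some ε > 0 with Cor. 1.9 unbeatable below 2 +
ε in every finite group) ⇒ close
`refuted:CorNineteenBeaten`: the whole single-TPP group-theoretic approach is dead, far beyond this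
route. A proof of ω = 2 elsewhere
moots the positive side but not the barrier items.

NOT DECOMPOSED YET. The layer-2 glue (a) (routine rpow bookkeeping + the explicit abelian subgroup;
filed the moment TowerPackingTight closes, pointless
before); the window decomposition (b) of the barrier (needs the congruence filtration of U_n(ℤ/p^k)
as Lean subgroups); the
multiscale "cascade" form of the box barrier below the top scale — deliberately NOT claimed
(near-solutions of valuation < k/2 are
not solutions and TPP does not descend to quotients G_k → G_m); GL_n / general smooth
ℤ_p-group-scheme versions of the three cruxes
(U_n chosen: nilpotent, n(G) = 1, explicit abelian subgroup, the live host of the sibling card); the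
STPP (simultaneous) analogue of
every item (CKSU Thm. 5.5 non-abelian is not in the tree; single TPP rests on the PROVED Cor. 1.9);
the Lie-level statement "TPP
triples of connected algebraic ℚ_p-subgroups have Σ dim ≤ dim G + O(rank)" (Kneser/Bruhat–Tits
anisotropy; PlatonovRapinchuk1994
Ch. 6) — untypable today and not load-bearing.

CHEAPEST FALSIFIER. For the line as drawn (both sides live until one closes) the cheapest decisive
experiment is a TPP-capacity search in the smallest
towers: β(U_3(ℤ/4)) (order 64), β(U_3(ℤ/8)) (512), β(U_3(ℤ/9)) (729), β(U_4(ℤ/4)) (4096) by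
HedtkeMurthy2012-style search
(arXiv:1104.5097; `kit compute`, not available to this planner seat): log β / log |G| clearly
increasing in k at fixed (p, n) sinks the
card's collapse claim (supports TowerCapacityGain); a ratio pinned at 1 + O(1/k) supports
TowerPackingFailure. Known-theorem checks
already run: Neumann2011 Cor. 4.2 (abelian subgroup of index v ⇒ β ≤ v²|G| = |G|^(5/3) for U_3
towers) and the normalizer barrier /
Murthy2026 Thm 3.1 (subgroup triples ≤ |G|^(4/3) in U_3 towers) are consistent with, and do not
decide, either side; the target
itself has no cheap falsifier (it is implied by, and nearly as strong as, ω = 2 via single TPP).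

NUMBERS. |U_n(ℤ/p^k)| = p^(kD), D = n(n−1)/2; abelian block subgroup |A| = p^(k⌊n²/4⌋), so d_max ≤
p^(k(D−⌊n²/4⌋)) = |G|^(1/2 − c_n) with
c_n = (2⌊n²/4⌋ − D)/(2D) = 1/(2n) (n odd), 1/(2(n−1)) (n even): c_3 = c_4 = 1/6, c_5 = c_6 = 1/10
(Isaacs1976 Problem 2.9(b);
D − ⌊n²/4⌋ = ⌊(n−1)²/4⌋; sharp for n = 3 at k = 1: U_3(𝔽_p) has irreducibles of degree p). Cor. 1.9
bookkeeping: packing exponent 3/2 − δ in U_n(ℤ/p^k) certifies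
ω ≤ 2/(1 − δ/(3c_n)) (n = 3: ω ≤ 2/(1 − 2δ); beating 3 needs δ < 1/6, i.e. exponent > 4/3 — exactly
the subgroup ceiling
3/2 − 1/(2D) = 4/3 from |Z| = p^k, BCGPU23 Cor. 3.8 / Murthy2026 Thm 3.1, so subgroup designs in U_3
towers certify nothing).
Always β(G) < |G|^(3/2) (Neumann2011 Cor. 3.2: β ≤ ((1+√(1+8|G|))/4)³); abelian β = |G|
(CohnUmans2003 Lemma 3.1, proved in tree as
RealizesTPP.mul_mul_le_card); abelian subgroup of index v ⇒ β ≤ v²|G| (Neumann2011 Cor. 4.2). Level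
one: extraspecial q^5 via an
anisotropic binary form realizes ⟨q², q², q²⟩, capacity |G|^(6/5), pseudo-exponent 2.5
(CohnUmans2003 arXiv text Cor. 15); packing-bound
families with LARGE d_max: S_{n(n+1)/2} (CU03 Thm 6), Cyc_{2n} ≀ S_n (CU03 Thm 17, α ≤ γ → 2).
Congruence filtration of GL_n(ℤ_p):
|Γ₁ : Γ_i| = p^(n²(i−1)), Γ_m/Γ_2m abelian (DixonEtAl1999 §5.1, Thm 5.2). Box barrier: first-order
boxes of ranks a, b, c inside a
d-dimensional group mod p^k are TPP only if a + b + c ≤ d, versus Σ dim = (3/2)dim − O(n) over ℝ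
(CU03 (U⁺,U⁻,SO_n); BCGPU23 Thm 4.9–4.10)
and Σ dim ≤ dim G over ℂ (BCGPU23 Thm 4.7). n(U_n(ℤ/p^k)) = 1 < |G|^δ (BCGPU23 Thm 3.2
inapplicable); |Z(U_n(ℤ/p^k))| = p^k = |G|^(1/D).

DEFINITION REQUESTS. None. TripleProductProperty (CU03 Def. 2.1, Finset form), RealizesTPP,
maxCharDegree / charDegrees, CKSU2005_cor19(_holds) and
omega_two_le all exist in the tree; U_n(ℤ/p^k) is written as the unitriangular Finset predicate
inside Matrix.GeneralLinearGroup (Fin n)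
(ZMod (p^k)) (no new notion). Bib entry Isaacs1976 added this session (commit 88860ffa35d8).

Novelty: Searches (2026-08-15, 18:30–19:00Z; searchd local/hybrid index DOWN rc 75, galaxy + zbMATH up): `lit
galaxy search "triple product property" --star all` (13 rows: Landsberg's book, Stothers' thesis,
BCGPU25 LIPIcs = arXiv:2410.14905, Sawin arXiv:1702.00905, CKSU05; nothing p-adic / congruence);
`lit galaxy search "representation zeta function unitriangular" --star all` (0); `lit search
--source zbmath "group-theoretic matrix multiplication triple product property"` (5:
arXiv:2410.14905, arXiv:1305.0448, arXiv:1107.5973, arXiv:1104.5097, arXiv:1107.5969 — TPP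
search/capacity papers, none over ℤ/p^k); zbMATH "triple product property matrix multiplication
p-groups" (0), "matrix multiplication profinite group" (2, irrelevant), "irreducible characters
unitriangular group over finite ring" (5: Sangroniz 2004, André 1995/2008 supercharacters, Szechtman
et al. 2017 McLain groups, Bardestani et al. 2016 — degree theory of the hosts, no TPP); full-text
greps of the held arXiv:2204.03826 (Def. 2.3, p. 3 "we know of no constructions in finite groups of
Lie type that even meet the packing bound", Thm 4.7, p. 9 "fewer points over ℝ") and
arXiv:math/0307321 (Thm 6, Cor. 15, Thm 17, §7 solvable-groups programme); Isaacs1976 read (galaxy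
panama:206579337003078: Problem 2.9(b) p. 30, Thm 6.15 p. 84); the ledger: all 60 Theses headers of
the sub, the negatives index (1 entry, unrelated), the four congruence-tower cards and their audits
(refuter-novelty-audit 7/10/11: "no printed answer", BCCGU1  [refs: 2410.14905, 1702.00905, 1305.0448, 1107.5973, 1104.5097, 1107.5969, 2204.03826, math/0307321, 2602.15796, Isaacs1976, BlasiakCohnGrochowPrattUmans2023, CohnUmans2003, Murthy2026, Neumann2011]

Barriers (technique_class: group-theoretic-TPP, p-adic congruence towers, barrier): - technique_class: group-theoretic-TPP, p-adic congruence towers, barrier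
- Literature.Barriers.MatrixMultiplication.NilpotentGroupBarrier: evaded formally — BCCGU2017_cor320
needs bounded exponent AND class, Sawin2018_thm15 / BCCGU2017_cor211 concern powers of one fixed
group; here each U_n(ℤ/p^k) is used ONCE, its exponent p^(k+O(1)) is unbounded, and the items are
single-TPP (the bet: slice rank of F_p[U_n(ℤ/p^k)] saves only |G|^(O(1/k)), as for ℤ/p^k itself,
BCCGU17 Thm B.8 / Ex. 3.13–3.14).
- Literature.Barriers.MatrixMultiplication.TricoloredSumFreeBarrier: abelian bounded-exponent STPP
only; the hosts are non-abelian of unbounded exponent (n = 2 is abelian and excluded by 2 ≤ n /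
irrelevant to ∃); n/a except as the model of what a tower-barrier proof cannot use.
- Literature.Barriers.MatrixMultiplication.QuasirandomBarrier: BCGPU2023_thm32 needs n(G) ≥ |G|^δ;
p-groups have non-trivial linear characters, n(U_n(ℤ/p^k)) = 1, so the barrier is vacuous here (this
is WHY towers are attractive and why a separate barrier item is needed).
- Literature.Barriers.MatrixMultiplication.NormalizerBarrier: applies to SUBGROUP triples and is
USED, not evaded: normalizerBarrier_holds (Cor. 3.8: (|H₁||H₂||H₃|)²|Z(G)| ≤ |G|³) with
|Z(U_n(ℤ/p^k))| = p^k caps subgroup designs at exponent 3/2 − 1/(2D) uniformly in k, so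
TowerPackingTight must use non-subgroup, digit-restricted subsets; the cruxes quantify over
arbitrary subsets.
- Literature.Barriers.MatrixMultiplication.IrreversibilityBarri

Novelty grade: new-combination — g44-38. PRIOR ART (roles verified): CohnUmans2003 (TPP, Lemma 3.1 abelian packing, Thm 6/17 packing-bound families with large d_max, Cor. 15 extraspecial gain), CKSU2005 Cor. 1.9 (PROVED in tree; the deciding inequality), BlasiakCohnGrochowPrattUmans2023 = arXiv:2204.03826 (packing bound Def 2.3, Li (refuter refuter-refute-pool-g44-38, 2026-08-15T20:08:12Z; prior: CohnUmans2003, CohnKleinbergSzegedyUmans2005, arXiv:2204.03826, BlasiakChurchCohnGrochowUmans2017, Sawin2018, Neumann2011, Murthy2026, DixonEtAl1999, Isaacs1976, arXiv:2410.14905)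

History (route lifecycle, newest last):
- 2026-08-16T04:10:38Z · AUTO-CRUX (backfill): CorNineteenBeaten — hypotheses of the deciding theorem that nothing in the route derives are cruxes (operator:999:1085951)
- 2026-08-21T16:46:55Z · DORMANT — reconciler: no traction for 5 d (last activity item-evidence-added at 2026-08-16T16:18:28Z); parked, not closed — `ledger route dormant route-MatrixMultiplicati (operator:999:3243131)

sub-problem: MatrixMultiplication · status: dormant · opened planner-plancard-MatrixMultiplication-MatrixM-cceef64f-g2-0 2026-08-15T18:54:01Z · rev 2 · ledger route-MatrixMultiplication-CongruenceTowerPacking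
GENERATED by the gate from the ledger (D-0016/17). Provers cite these decls: `theorem foo : Summit.MatrixMultiplication.MatrixMultiplication.Theses.CongruenceTowerPacking.<Decl> := …` in Summits/MatrixMultiplication/MatrixMultiplication/Theorems/<Name>.lean.
-/

namespace Summit.MatrixMultiplication.MatrixMultiplication.Theses.CongruenceTowerPacking

open scoped BigOperators Topology Manifold Classical MeasureTheory ProbabilityTheory Matrix InnerProductSpace ComplexConjugate ContinuousMap
open Filter Set Function TopologicalSpace MeasureTheory

attribute [summit_statement] _root_.MatrixMultiplication

/-- item stmt-MatrixMultiplication-12340 · crux (kind.auto-crux: conjecture-grade) · rank 0 · open · by planner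
why it might fail: Equivalent in strength to "single-TPP designs push the Cor. 1.9 bound to 2": packing-bound families exist (CU03 Thm 6, Thm 17: S_{n(n+1)/2}, A≀S_n) but with d_max ≥ |G|^(1/2−o(1)); no family with d_max ≤ |G|^(1/2−c) meeting it is known.
sources: CohnKleinbergSzegedyUmans2005, CohnUmans2003, BlasiakCohnGrochowPrattUmans2023, lean:Literature.Computability.AlgebraicComplexity.CKSU2005_cor19_holds
[target] X: for every τ > 2 there are a finite group G and S, T, U ⊆ G with the triple product
property (CohnUmans2003 Def. 2.1, the tree's TripleProductProperty) such that d_max(G)^(τ−2)·|G| <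
(|S||T||U|)^(τ/3) — Cor. 1.9 of CKSU 2005 is beaten at every exponent above 2 (host-agnostic
deciding interface; the tower cruxes below are the proposed witnesses). [difficulty: open-problem] -/
@[route_item "route-MatrixMultiplication-CongruenceTowerPacking", crux]
def CorNineteenBeaten : Prop :=
  ∀ τ : ℝ, 2 < τ → ∃ (G : Type) (_ : Group G) (_ : Fintype G) (S T U : Finset G), Literature.Combinatorics.Additive.TripleProductProperty S T U ∧ (Literature.RepresentationTheory.FiniteGroups.maxCharDegree G : ℝ) ^ (τ - 2) * (Fintype.card G : ℝ) < ((S.card * T.card * U.card : ℕ) : ℝ) ^ (τ / 3)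

/-- item stmt-MatrixMultiplication-12341 · crux · rank 2 · open · by planner
why it might fail: May be FALSE: carry-aware digit-restricted designs (card unipotent-congruence-towers) escape the box barrier; slice rank is powerless at unbounded exponent (BCCGU17 Thm B.8: ℤ/p^k has full slice rank); only the abelian top window and subgroup triples are controlled.
sources: BlasiakCohnGrochowPrattUmans2023, BlasiakChurchCohnGrochowUmans2017, CohnUmans2003, Neumann2011, Murthy2026, arXiv:2410.14905
[crux] THE BARRIER (card nonarchimedean-lie-tpp-collapse, "no bound ω < 3 survives" made honest at
the packing scale): for every prime p and every n there is c = c(p, n) > 0 such that for ALL depths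
k every triple (S, T, U) of upper unitriangular matrices in GL_n(ℤ/p^k) with the triple product
property has |S||T||U| ≤ p^(k·n(n−1)/2·(3/2 − c)) = |U_n(ℤ/p^k)|^(3/2−c): fixed-dimension unipotent
congruence towers never meet the packing bound (BCGPU23 Def. 2.3). Equivalent to ¬TowerPackingTight
by elementary bookkeeping (a prover settling either should land the other's negation in the same
Theorems file). PROVED for SUBGROUP triples by the tree's normalizer barrier (|Z(U_n(ℤ/p^k))| = p^k
gives c = 1/(2D), D = n(n−1)/2) and for first-order boxes by AnalyticBoxBarrier; open for
digit-restricted subsets. [difficulty: open-problem] -/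
@[route_item "route-MatrixMultiplication-CongruenceTowerPacking"]
def TowerPackingFailure : Prop :=
  ∀ (p n : ℕ), Nat.Prime p → ∃ c : ℝ, 0 < c ∧ ∀ (k : ℕ) (S T U : Finset (Matrix.GeneralLinearGroup (Fin n) (ZMod (p ^ k)))), (∀ s ∈ S ∪ T ∪ U, ∀ i j : Fin n, (i = j → (s : Matrix (Fin n) (Fin n) (ZMod (p ^ k))) i j = 1) ∧ (j < i → (s : Matrix (Fin n) (Fin n) (ZMod (p ^ k))) i j = 0)) → Literature.Combinatorics.Additive.TripleProductProperty S T U → ((S.card * T.card * U.card : ℕ) : ℝ) ≤ (p : ℝ) ^ ((k : ℝ) * ((n : ℝ) * ((n : ℝ) - 1) / 2) * (3 / 2 - c))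

/-- item stmt-MatrixMultiplication-12342 · crux · rank 3 · open · by planner
why it might fail: The card's cascade may be right: level-1 gains (CU03 Cor. 15: extraspecial q^5, capacity |G|^(6/5); Murthy2026 Thm 3.1 class 2) need not propagate in k — the tower has no product structure and its windows K_j/K_2j are abelian (capacity exactly |window|).
sources: CohnUmans2003, Murthy2026, Neumann2011, HedtkeMurthy2012, Hedtke2011, DixonEtAl1999
[crux] FIRST MILESTONE / the card's literal collapse claim negated: there are a prime p, a dimension
n ≥ 2 and η > 0 such that for infinitely many depths k some TPP triple of upper unitriangular
matrices in GL_n(ℤ/p^k) has |S||T||U| ≥ p^(k·n(n−1)/2·(1+η)) = |U_n(ℤ/p^k)|^(1+η) — a k-UNIFORM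
capacity gain survives in the tower. The spine card asserts the negation (capacity |G_k|^(1+o(1)):
"p-adic TPP triples collapse under reduction mod p^k"); TowerPackingTight implies it (k(δ) → ∞ as δ
→ 0 since β(G) < |G|^(3/2), Neumann2011 Cor. 3.2). Both sides staffed; computable at small (p, k).
[difficulty: L] -/
@[route_item "route-MatrixMultiplication-CongruenceTowerPacking"]
def TowerCapacityGain : Prop :=
  ∃ (p n : ℕ) (η : ℝ), Nat.Prime p ∧ 2 ≤ n ∧ 0 < η ∧ ∀ k₀ : ℕ, ∃ k : ℕ, k₀ ≤ k ∧ ∃ S T U : Finset (Matrix.GeneralLinearGroup (Fin n) (ZMod (p ^ k))), (∀ s ∈ S ∪ T ∪ U, ∀ i j : Fin n, (i = j → (s : Matrix (Fin n) (Fin n) (ZMod (p ^ k))) i j = 1) ∧ (j < i → (s : Matrix (Fin n) (Fin n) (ZMod (p ^ k))) i j = 0)) ∧ Literature.Combinatorics.Additive.TripleProductProperty S T U ∧ (p : ℝ) ^ ((k : ℝ) * ((n : ℝ) * ((n : ℝ) - 1) / 2) * (1 + η)) ≤ ((S.card * T.card * U.card : ℕ) : ℝ)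

/-- item stmt-MatrixMultiplication-12343 · crux · rank 4 · open · by planner
why it might fail: Probably false (it is ¬TowerPackingFailure): subgroup triples are capped at exponent 3/2 − 1/(2D) (normalizer barrier, Murthy2026), first-order boxes at the abelian bound (AnalyticBoxBarrier); no packing-bound family is known in any p-group or Lie-type host (BCGPU23 p. 3).
sources: BlasiakCohnGrochowPrattUmans2023, CohnUmans2003, CohnKleinbergSzegedyUmans2005, arXiv:1712.02302, arXiv:2410.14905, Isaacs1976
[crux] THE CONSTRUCTION (card unipotent-congruence-towers, crux (3) there): for some prime p and n ≥
2, for every δ > 0 some depth k ≥ 1 admits a TPP triple of upper unitriangular matrices in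
GL_n(ℤ/p^k) with |S||T||U| ≥ p^(k·n(n−1)/2·(3/2 − δ)) — the tower meets the packing bound. With
DegreeLeIndexAbelian (d_max(U_n(ℤ/p^k)) ≤ p^(k(D − ⌊n²/4⌋)) = |G_k|^(1/2 − c_n), c_n = (2⌊n²/4⌋ −
D)/(2D) = 1/(2n) for odd n, 1/(2(n−1)) for even n) it implies the target by Cor. 1.9 bookkeeping:
given τ > 2 take δ < 3c_n(τ−2)/τ. [deps: DegreeLeIndexAbelian] [difficulty: open-problem] -/
@[route_item "route-MatrixMultiplication-CongruenceTowerPacking"]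
def TowerPackingTight : Prop :=
  ∃ (p n : ℕ), Nat.Prime p ∧ 2 ≤ n ∧ ∀ δ : ℝ, 0 < δ → ∃ k : ℕ, 1 ≤ k ∧ ∃ S T U : Finset (Matrix.GeneralLinearGroup (Fin n) (ZMod (p ^ k))), (∀ s ∈ S ∪ T ∪ U, ∀ i j : Fin n, (i = j → (s : Matrix (Fin n) (Fin n) (ZMod (p ^ k))) i j = 1) ∧ (j < i → (s : Matrix (Fin n) (Fin n) (ZMod (p ^ k))) i j = 0)) ∧ Literature.Combinatorics.Additive.TripleProductProperty S T U ∧ (p : ℝ) ^ ((k : ℝ) * ((n : ℝ) * ((n : ℝ) - 1) / 2) * (3 / 2 - δ)) ≤ ((S.card * T.card * U.card : ℕ) : ℝ)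

/-- item stmt-MatrixMultiplication-12344 · support · rank 9 · closed · proved by Summit.MatrixMultiplication.MatrixMultiplication.Theorems.analyticBoxBarrier_proof @ 045c7b513df3 (prover) · by planner
sources: CohnUmans2003, Neumann2011, DixonEtAl1999, BlasiakCohnGrochowPrattUmans2023
[support] The spine card's collapse lemma in its true, provable form (gen-1 target, re-filed as
support): let R = ℤ/p^k with m < k ≤ 2m and π = p^m (so π² = 0 and K_m = 1 + π·M_n(R) is ABELIAN);
if S ⊆ g₁(1 + π D₁(R^a)), T ⊆ g₂(1 + π D₂(R^b)), U ⊆ g₃(1 + π D₃(R^c)) are first-order boxes (=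
images mod p^k of analytic charts inside one residue class mod p^m) whose conjugated tangents
gᵢDᵢ(·)gᵢ⁻¹ lie in a d-generated submodule L ≤ M_n(R), and (S, T, U) has the TPP, then |S||T||U| ≤
p^((k−m)d) = |πR|^d. Proof: right-translate by gᵢ⁻¹ (TPP-invariant, Neumann2011 Obs. 2.1) into the
abelian group 1 + πL, where the product map of a TPP triple is injective (CohnUmans2003 Lemma 3.1).
Consequence: full boxes of ranks a+b+c > d are never TPP — the discretised p-adic analogue of
BCGPU23 Thm 4.7 that FAILS over ℝ (CU03 (U⁺, U⁻, SO_n); BCGPU23 Thm 4.10) — and any design for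
TowerPackingTight must be digit-restricted at ≥ half of the scales. [difficulty: provable-now] -/
@[route_item "route-MatrixMultiplication-CongruenceTowerPacking"]
def AnalyticBoxBarrier : Prop :=
  ∀ (p k m n a b c d : ℕ), Nat.Prime p → m < k → k ≤ 2 * m → ∀ (g₁ g₂ g₃ : Matrix.GeneralLinearGroup (Fin n) (ZMod (p ^ k))) (D₁ : (Fin a → ZMod (p ^ k)) →ₗ[ZMod (p ^ k)] Matrix (Fin n) (Fin n) (ZMod (p ^ k))) (D₂ : (Fin b → ZMod (p ^ k)) →ₗ[ZMod (p ^ k)] Matrix (Fin n) (Fin n) (ZMod (p ^ k))) (D₃ : (Fin c → ZMod (p ^ k)) →ₗ[ZMod (p ^ k)] Matrix (Fin n) (Fin n) (ZMod (p ^ k))) (gen : Fin d → Matrix (Fin n) (Fin n) (ZMod (p ^ k))), (∀ x, (g₁.val * D₁ x * g₁⁻¹.val : Matrix (Fin n) (Fin n) (ZMod (p ^ k))) ∈ Submodule.span (ZMod (p ^ k)) (Set.range gen)) → (∀ y, (g₂.val * D₂ y * g₂⁻¹.val : Matrix (Fin n) (Fin n) (ZMod (p ^ k))) ∈ Submodule.span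 (ZMod (p ^ k)) (Set.range gen)) → (∀ z, (g₃.val * D₃ z * g₃⁻¹.val : Matrix (Fin n) (Fin n) (ZMod (p ^ k))) ∈ Submodule.span (ZMod (p ^ k)) (Set.range gen)) → ∀ (S T U : Finset (Matrix.GeneralLinearGroup (Fin n) (ZMod (p ^ k)))), (∀ s ∈ S, ∃ x, (s : Matrix (Fin n) (Fin n) (ZMod (p ^ k))) = g₁.val * (1 + ((p : ZMod (p ^ k)) ^ m) • D₁ x)) → (∀ t ∈ T, ∃ y, (t : Matrix (Fin n) (Fin n) (ZMod (p ^ k))) = g₂.val * (1 + ((p : ZMod (p ^ k)) ^ m) • D₂ y)) → (∀ u ∈ U, ∃ z, (u : Matrix (Fin n) (Fin n) (ZMod (p ^ k))) = g₃.val * (1 + ((p : ZMod (p ^ k)) ^ m) • D₃ z)) → Literature.Combinatorics.Additive.TripleProductProperty S T U → S.card * T.card * U.card ≤ p ^ ((k - m) * d)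

/-- item stmt-MatrixMultiplication-12345 · support · rank 9 · closed · proved by Summit.MatrixMultiplication.MatrixMultiplication.Theorems.DegreeLeIndexAbelian_proof @ 3c3867751c78 (prover) · by planner
sources: Isaacs1976, CohnUmans2003
[support] (Isaacs1976 Problem 2.9(b); cf. Ito's Theorem 6.15 for normal A) every irreducible
character degree of a finite group G is at most the index of any abelian subgroup A ≤ G: d ≤ [G : A]
for all d ∈ charDegrees G. The degree engine of the positive side: with A the abelian block subgroup
of U_n(ℤ/p^k) (entries in rows ≤ ⌊n/2⌋, columns > ⌊n/2⌋, |A| = p^(k⌊n²/4⌋)) it gives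
d_max(U_n(ℤ/p^k)) ≤ p^(k(n(n−1)/2 − ⌊n²/4⌋)) uniformly in k (n = 3: d_max ≤ p^k = |G|^(1/3)).
[difficulty: M] -/
@[route_item "route-MatrixMultiplication-CongruenceTowerPacking"]
def DegreeLeIndexAbelian : Prop :=
  ∀ (G : Type) [Group G] [Finite G] (A : Subgroup G), (∀ a ∈ A, ∀ b ∈ A, a * b = b * a) → ∀ d ∈ Literature.RepresentationTheory.FiniteGroups.charDegrees G, d ≤ A.index

/-- item stmt-MatrixMultiplication-12346 · assembly · rank 1 · closed · proved by Summit.MatrixMultiplication.MatrixMultiplication.Theorems.congruenceTowerPacking_assembly_proof (prover) · by planner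
sources: CohnKleinbergSzegedyUmans2005, lean:Literature.Computability.AlgebraicComplexity.CKSU2005_cor19_holds, lean:Literature.Computability.AlgebraicComplexity.omega_two_le
[assembly] CorNineteenBeaten → MatrixMultiplication (the type of the deciding theorem `closes`,
proved in glue.lean from CKSU2005_cor19_holds and omega_two_le). -/
@[route_item "route-MatrixMultiplication-CongruenceTowerPacking"]
def Assembly : Prop :=
  CorNineteenBeaten → MatrixMultiplication

/-! D-0027 §2.1 — DECIDING THEOREM (planner-authored via `route open/edit --closes-file`; by planner-plancard-MatrixMultiplication-MatrixM-cceef64f-g2-0 2026-08-15T18:54:01Z):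
its hypotheses are this route's items and its conclusion the sub-problem Statement (glue_lint), and it elaborates with this file. -/

/-- DECIDING THEOREM (D-0027 §2.1): the target `CorNineteenBeaten` alone decides `ω(ℂ) = 2`.
`ω(ℂ) ≥ 2` is the flattening bound (`omega_two_le`, PROVED in tree); if `ω(ℂ) > 2`, apply the target
at `τ := ω(ℂ)` to get a finite group `G` and a TPP triple `(S, T, U)` with
`d_max(G)^(ω−2)·|G| < (|S||T||U|)^(ω/3)`; but `⟨S, T, U⟩` realizes `⟨|S|,|T|,|U|⟩` (`RealizesTPP`, same
inlined predicate as `TripleProductProperty`), so Cohn–Kleinberg–Szegedy–Umans 2005, Cor. 1.9 — PROVED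
in tree as `CKSU2005_cor19_holds` — gives `(|S||T||U|)^(ω/3) ≤ d_max(G)^(ω−2)·|G|`: contradiction.
No Literature fact is assumed. The tower cruxes (`TowerPackingTight` with `DegreeLeIndexAbelian` ⇒ the
target; `TowerPackingFailure`, `TowerCapacityGain` on the negative/milestone side) are deliberately not
hypotheses. -/
@[closes "route-MatrixMultiplication-CongruenceTowerPacking"] theorem closes (h : CorNineteenBeaten) : MatrixMultiplication := by
  rw [MatrixMultiplication_iff]
  by_contra hne
  have h2 : (2 : ℝ) < Literature.Computability.AlgebraicComplexity.omega ℂ :=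
    lt_of_le_of_ne (Literature.Computability.AlgebraicComplexity.omega_two_le ℂ) (Ne.symm hne)
  obtain ⟨G, _, _, S, T, U, hTPP, hlt⟩ := h _ h2
  have hR : Literature.Computability.AlgebraicComplexity.RealizesTPP G S.card T.card U.card :=
    ⟨S, T, U, rfl, rfl, rfl, hTPP⟩
  have hle :=
    Literature.Computability.AlgebraicComplexity.CKSU2005_cor19_holds G S.card T.card U.card hR
  rw [Nat.card_eq_fintype_card] at hle
  exact lt_irrefl _ (hlt.trans_le hle)

end Summit.MatrixMultiplication.MatrixMultiplication.Theses.CongruenceTowerPacking
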